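import Mathlib
import Literature.NumberTheory.Sieve.IntervalResidueClassSieveSigned
import Literature.NumberTheory.Sieve.ParityBarrier
import Summits.Parity.GeneralizedHardyLittlewood.Theorems.ParityLeakOneFifthPlainSplitTwistedModel
import Summits.Parity.GeneralizedHardyLittlewood.Theorems.ParityLeakOneFifthPlainSplitTwistedRemainder
import Summits.Parity.GeneralizedHardyLittlewood.Theorems.ParityLeakOneFifthPlainSplitTwistedRemainderSum
import HarnessLib

/-!
# Route ParityLeakOneFifth, crux `PlainSplit` (stmt-Parity-18382), skeleton `calib-split`:
# tools for stub `stub_roughLiouvilleTwistedSmall`, IV — density product and the remainder for one `d`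

* `prod_classes_le`: with `#Ω p < p`, `#Ω p ≥ 1` everywhere and `#Ω p ≥ 2` at the odd primes
  `p < z`, `∏_{p<w} (1 − #Ω p/p) ≤ 2 V(z) ∏_{p<w} (1 − 1/p)` (`1 − 2/p ≤ (1 − 1/p)²`);
* `remainder_le`: the remainder classes of the signed interval sieve for `S_d`, reduced class by
  class to Bombieri–Vinogradov shape (parts II–III) and summed:
  `≤ 2 C_BV ((2x+2)/d)(1 + log L)/ℓ³` when every `log((2x+2)/(dg)) ≥ ℓ`, `g ≤ ⌊L⌋`.
-/

namespace Summit.Parity.GeneralizedHardyLittlewood.Theorems.ParityLeakOneFifth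


open Finset
open Literature.NumberTheory.Sieve

/-- **The density product with two classes below `z`.**  If `#Ω p < p`, `#Ω p ≥ 1` at every prime
and `#Ω p ≥ 2` at the odd primes `p < z` (`2 < z ≤ w`), then
`∏_{p<w} (1 − #Ω p/p) ≤ 2 V(z) ∏_{p<w} (1 − 1/p)`, `V(z) = ∏_{p<z}(1 − 1/p)`
(from `1 − 2/p ≤ (1 − 1/p)²`). -/
theorem prod_classes_le {z w : ℝ} (hz : 2 < z) (hzw : z ≤ w) (Ω : ℕ → Finset ℕ)
    (hlt : ∀ p : ℕ, p.Prime → #(Ω p) < p) (h1 : ∀ p : ℕ, p.Prime → 1 ≤ #(Ω p))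
    (h2 : ∀ p ∈ Nat.primesBelow ⌈z⌉₊, p ≠ 2 → 2 ≤ #(Ω p)) :
    ∏ p ∈ Nat.primesBelow ⌈w⌉₊, (1 - (#(Ω p) : ℝ) / p) ≤
      2 * (∏ p ∈ (Finset.range ⌈z⌉₊).filter Nat.Prime, (1 - 1 / (p : ℝ))) *
        ∏ p ∈ Nat.primesBelow ⌈w⌉₊, (1 - (p : ℝ)⁻¹) := by
  set Pz := Nat.primesBelow ⌈z⌉₊ with hPz
  set Pw := Nat.primesBelow ⌈w⌉₊ with hPw
  have hsub : Pz ⊆ Pw := by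
    intro p hp
    rw [hPz, Nat.mem_primesBelow] at hp
    rw [hPw, Nat.mem_primesBelow]
    exact ⟨lt_of_lt_of_le hp.1 (Nat.ceil_mono hzw), hp.2⟩
  have hPB : (Finset.range ⌈z⌉₊).filter Nat.Prime = Pz := rfl
  rw [hPB]
  simp only [one_div]
  set f : ℕ → ℝ := fun p => 1 - (#(Ω p) : ℝ) / p with hf
  set g : ℕ → ℝ := fun p => 1 - (p : ℝ)⁻¹ with hg
  have hprime : ∀ p ∈ Pw, p.Prime := fun p hp => (Nat.mem_primesBelow.1 hp).2
  have hf0 : ∀ p ∈ Pw, 0 ≤ f p := by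
    intro p hp
    have hpp := hprime p hp
    have : (#(Ω p) : ℝ) ≤ p := by exact_mod_cast (hlt p hpp).le
    have hp0 : (0 : ℝ) < p := by exact_mod_cast hpp.pos
    simp only [hf]; rw [sub_nonneg, div_le_one hp0]; exact this
  have hfg : ∀ p ∈ Pw, f p ≤ g p := by
    intro p hp
    have hpp := hprime p hp
    have hp0 : (0 : ℝ) < p := by exact_mod_cast hpp.pos
    have : (1 : ℝ) ≤ #(Ω p) := by exact_mod_cast h1 p hpp
    simp only [hf, hg]
    rw [inv_eq_one_div]
    have := div_le_div_of_nonneg_right this hp0.le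
    linarith
  have hg0 : ∀ p ∈ Pw, 0 ≤ g p := fun p hp => (hf0 p hp).trans (hfg p hp)
  -- split the product at `z`
  rw [← Finset.prod_sdiff hsub, ← Finset.prod_sdiff hsub (f := g)]
  -- the part below `z`
  have h2mem : 2 ∈ Pz := by
    rw [hPz, Nat.mem_primesBelow]
    exact ⟨Nat.lt_ceil.2 (by push_cast; linarith), Nat.prime_two⟩
  set b : ℕ → ℝ := fun p => if p = 2 then 1 / 2 else g p ^ 2 with hb
  have hfb : ∀ p ∈ Pz, f p ≤ b p := by
    intro p hp
    have hpp := hprime p (hsub hp)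
    have hp0 : (0 : ℝ) < p := by exact_mod_cast hpp.pos
    simp only [hb]
    split_ifs with hp2
    · subst hp2
      have : (1 : ℝ) ≤ #(Ω 2) := by exact_mod_cast h1 2 Nat.prime_two
      simp only [hf]; push_cast; linarith [div_le_div_of_nonneg_right this (by norm_num : (0:ℝ) ≤ 2)]
    · have : (2 : ℝ) ≤ #(Ω p) := by exact_mod_cast h2 p hp hp2
      simp only [hf, hg]
      have e : (1 - (p : ℝ)⁻¹) ^ 2 = 1 - 2 / p + 1 / (p : ℝ) ^ 2 := by field_simp; ring
      rw [e]
      have h3 := div_le_div_of_nonneg_right this hp0.le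
      have h4 : (0 : ℝ) ≤ 1 / (p : ℝ) ^ 2 := by positivity
      linarith
  have hPz1 : ∏ p ∈ Pz, f p ≤ ∏ p ∈ Pz, b p :=
    Finset.prod_le_prod (fun p hp => hf0 p (hsub hp)) hfb
  have hPz2 : ∏ p ∈ Pz, b p = 2 * (∏ p ∈ Pz, g p) ^ 2 := by
    rw [← Finset.mul_prod_erase Pz b h2mem, ← Finset.mul_prod_erase Pz g h2mem]
    have e1 : ∏ p ∈ Pz.erase 2, b p = ∏ p ∈ Pz.erase 2, g p ^ 2 := by
      refine Finset.prod_congr rfl fun p hp => ?_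
      simp only [hb]; rw [if_neg (Finset.ne_of_mem_erase hp)]
    rw [e1, Finset.prod_pow]
    simp only [hb, hg, if_true]
    norm_num; ring
  have hrest : ∏ p ∈ Pw \ Pz, f p ≤ ∏ p ∈ Pw \ Pz, g p :=
    Finset.prod_le_prod (fun p hp => hf0 p (Finset.sdiff_subset hp))
      (fun p hp => hfg p (Finset.sdiff_subset hp))
  have hA0 : 0 ≤ ∏ p ∈ Pw \ Pz, f p := Finset.prod_nonneg fun p hp => hf0 p (Finset.sdiff_subset hp)
  have hB0 : 0 ≤ ∏ p ∈ Pz, g p := Finset.prod_nonneg fun p hp => hg0 p (hsub hp)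
  have hB1 : ∏ p ∈ Pz, g p ≤ 1 := by
    refine Finset.prod_le_one (fun p hp => hg0 p (hsub hp)) fun p hp => ?_
    simp only [hg]
    have : (0 : ℝ) ≤ (p : ℝ)⁻¹ := by positivity
    linarith
  have hF0 : 0 ≤ ∏ p ∈ Pz, f p := Finset.prod_nonneg fun p hp => hf0 p (hsub hp)
  calc (∏ p ∈ Pw \ Pz, f p) * ∏ p ∈ Pz, f p
      ≤ (∏ p ∈ Pw \ Pz, g p) * (2 * (∏ p ∈ Pz, g p) ^ 2) := by
        rw [← hPz2]
        exact mul_le_mul hrest hPz1 hF0 ((hA0.trans hrest))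
    _ = 2 * (∏ p ∈ Pz, g p) * ((∏ p ∈ Pw \ Pz, g p) * ∏ p ∈ Pz, g p) := by ring

/-- `⌊A/q⌋ − ⌊B/q⌋ ≤ (A − B)/q + 1` for `B ≤ A`. -/
theorem natCast_div_sub_div_le {A B q : ℕ} (hBA : B ≤ A) (hq : 0 < q) :
    ((A / q - B / q : ℕ) : ℝ) ≤ ((A : ℝ) - B) / q + 1 := by
  have hq' : (0 : ℝ) < q := by exact_mod_cast hq
  have hle : B / q ≤ A / q := Nat.div_le_div_right hBA
  rw [Nat.cast_sub hle]
  have h1 : ((A / q : ℕ) : ℝ) ≤ (A : ℝ) / q := Nat.cast_div_le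
  have h2 : (B : ℝ) < ((B / q : ℕ) : ℝ) * q + q := by exact_mod_cast Nat.lt_div_mul_add (a := B) hq
  have h3 : (B : ℝ) / q - 1 < ((B / q : ℕ) : ℝ) := by
    rw [div_sub_one hq'.ne', div_lt_iff₀ hq']; linarith
  have e : (A : ℝ) / q - ((B : ℝ) / q - 1) = ((A : ℝ) - B) / q + 1 := by field_simp; ring
  linarith

/-- `Σ_{g ≤ ⌊L⌋} 1/g ≤ 1 + log L` for `L ≥ 1`. -/
theorem sum_Icc_inv_le_log {L : ℝ} (hL : 1 ≤ L) :
    ∑ g ∈ Finset.Icc 1 ⌊L⌋₊, (1 : ℝ) / g ≤ 1 + Real.log L := by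
  have h1 : ∑ g ∈ Finset.Icc 1 ⌊L⌋₊, (1 : ℝ) / g = (harmonic ⌊L⌋₊ : ℝ) := by
    rw [harmonic_eq_sum_Icc]; push_cast
    exact Finset.sum_congr rfl fun g _ => by simp
  rw [h1]
  refine (harmonic_le_one_add_log _).trans ?_
  have hL0 : 0 < L := by linarith
  have h2 : (1 : ℝ) ≤ ⌊L⌋₊ := by exact_mod_cast Nat.le_floor (by simpa using hL)
  linarith [Real.log_le_log (by linarith) (Nat.floor_le hL0.le)]

/-! ### The remainder for one `d` -/

set_option maxHeartbeats 800000 in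
/-- **The remainder classes for one `d`, summed.**  With classes `K_q ⊆ {0, t_q}` (all `< q`)
shifted by `K₀`, heights `K₀ ≤ K₁ ≤ (2x+2)/d`, and Bombieri–Vinogradov (exponent `3`, constant
`C_BV`, level `(log X)^{-B} X^{1/2}` beyond `X₀`) applicable at every `X_g = (2x+2)/(dg)`,
`g ≤ ⌊L⌋`, with `log X_g ≥ ℓ`:
`Σ_{e ∣ P(w), e ≤ L} Σ_{c adm} |Σ_{r ≤ K₁−K₀, r ≡ c (e)} λ(K₀+r)| ≤ 2 C_BV ((2x+2)/d)(1 + log L)/ℓ³`. -/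
theorem remainder_le {Cb B X₀r ℓ : ℝ} (hCb : 0 ≤ Cb) (hℓ : 0 < ℓ)
    (hBV : ∀ X : ℝ, X₀r ≤ X → ∀ Q : ℕ, (Q : ℝ) ≤ X ^ (1 / 2 : ℝ) / Real.log X ^ B →
      ∀ N : ℕ → ℕ, (∀ q, (N q : ℝ) ≤ X) → ∀ a : (q : ℕ) → ZMod q,
      (∀ q ∈ Finset.Icc 1 Q, IsUnit (a q)) →
        ∑ q ∈ Finset.Icc 1 Q, |∑ m ∈ (Finset.Icc 1 (N q)).filter (fun m : ℕ => (m : ZMod q) = a q),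
          (ArithmeticFunction.liouville m : ℝ)| ≤ Cb * X / Real.log X ^ (3 : ℝ))
    {x d K₀ K₁ : ℕ} {w L : ℝ} (hd : 1 ≤ d) (hK : K₀ ≤ K₁) (hL1 : 1 ≤ L)
    (hK₁ : (K₁ : ℝ) ≤ (2 * (x : ℝ) + 2) / d) (Kcl : ℕ → Finset ℕ) (t : ℕ → ℕ)
    (hKlt : ∀ p : ℕ, p.Prime → ∀ u ∈ Kcl p, u < p)
    (hK01 : ∀ p : ℕ, p.Prime → ∀ u ∈ Kcl p, u = 0 ∨ u = t p)
    (hlev : ∀ g ∈ Finset.Icc 1 ⌊L⌋₊, X₀r ≤ (2 * (x : ℝ) + 2) / ((d : ℝ) * g) ∧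
      ((⌊L⌋₊ / g : ℕ) : ℝ) ≤ ((2 * (x : ℝ) + 2) / ((d : ℝ) * g)) ^ (1 / 2 : ℝ) /
        Real.log ((2 * (x : ℝ) + 2) / ((d : ℝ) * g)) ^ B ∧
      ℓ ≤ Real.log ((2 * (x : ℝ) + 2) / ((d : ℝ) * g))) :
    ∑ e ∈ (primesProdBelow w).divisors.filter (fun e : ℕ => (e : ℝ) ≤ L),
      ∑ c ∈ (Finset.range e).filter (fun c : ℕ => ∀ q ∈ e.primeFactors,
        c % q ∈ (Kcl q).image (fun u : ℕ => (u + (q - K₀ % q)) % q)),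
        |∑ r ∈ (Finset.Icc 1 (K₁ - K₀)).filter (fun r : ℕ => r % e = c),
          (ArithmeticFunction.liouville (K₀ + r) : ℝ)| ≤
      2 * Cb * ((2 * (x : ℝ) + 2) / d) * (1 + Real.log L) / ℓ ^ 3 := by
  have hd' : (0 : ℝ) < d := by exact_mod_cast hd
  set Lf := ⌊L⌋₊ with hLf
  -- the maximal reduced class sums
  set Mx : ℕ → ℕ → ℝ := fun N q =>
    if h : ((Finset.range q).filter (fun u : ℕ => Nat.Coprime u q)).Nonempty then
      ((Finset.range q).filter (fun u : ℕ => Nat.Coprime u q)).sup' h (fun u : ℕ =>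
        |∑ m ∈ (Finset.Icc 1 N).filter (fun m : ℕ => (m : ZMod q) = (u : ZMod q)),
          (ArithmeticFunction.liouville m : ℝ)|)
    else 0 with hMx
  have hMxle : ∀ N q u : ℕ, u < q → Nat.Coprime u q →
      |∑ m ∈ (Finset.Icc 1 N).filter (fun m : ℕ => (m : ZMod q) = (u : ZMod q)),
        (ArithmeticFunction.liouville m : ℝ)| ≤ Mx N q := by
    intro N q u hu hcop
    have hmem : u ∈ (Finset.range q).filter (fun u : ℕ => Nat.Coprime u q) :=
      Finset.mem_filter.2 ⟨Finset.mem_range.2 hu, hcop⟩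
    have hne : ((Finset.range q).filter (fun u : ℕ => Nat.Coprime u q)).Nonempty := ⟨u, hmem⟩
    simp only [hMx, dif_pos hne]
    exact Finset.le_sup' (fun u : ℕ => |∑ m ∈ (Finset.Icc 1 N).filter
      (fun m : ℕ => (m : ZMod q) = (u : ZMod q)), (ArithmeticFunction.liouville m : ℝ)|) hmem
  have hMx0 : ∀ N q : ℕ, 0 ≤ Mx N q := by
    intro N q
    simp only [hMx]
    split_ifs with h
    · obtain ⟨u, hu⟩ := h
      exact le_trans (abs_nonneg _) (Finset.le_sup' (fun u : ℕ => |∑ m ∈ (Finset.Icc 1 N).filter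
        (fun m : ℕ => (m : ZMod q) = (u : ZMod q)), (ArithmeticFunction.liouville m : ℝ)|) hu)
    · exact le_rfl
  set F : ℕ → ℕ → ℝ := fun g e' => Mx (K₁ / g) e' + Mx (K₀ / g) e' with hF
  have hF0 : ∀ g e', 0 ≤ F g e' := fun g e' => add_nonneg (hMx0 _ _) (hMx0 _ _)
  -- step 1: classes of one modulus
  have step1 : ∀ e ∈ (primesProdBelow w).divisors.filter (fun e : ℕ => (e : ℝ) ≤ L),
      ∑ c ∈ (Finset.range e).filter (fun c : ℕ => ∀ q ∈ e.primeFactors,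
        c % q ∈ (Kcl q).image (fun u : ℕ => (u + (q - K₀ % q)) % q)),
        |∑ r ∈ (Finset.Icc 1 (K₁ - K₀)).filter (fun r : ℕ => r % e = c),
          (ArithmeticFunction.liouville (K₀ + r) : ℝ)| ≤
      ∑ g ∈ e.divisors, F g (e / g) := by
    intro e he
    rw [Finset.mem_filter, Nat.mem_divisors] at he
    have hsq : Squarefree e := (squarefree_primesProdBelow w).squarefree_of_dvd he.1.1
    have he0 : e ≠ 0 := hsq.ne_zero
    have he0' : 0 < e := Nat.pos_of_ne_zero he0
    have hadm : ∀ c ∈ (Finset.range e).filter (fun c : ℕ => ∀ q ∈ e.primeFactors,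
        c % q ∈ (Kcl q).image (fun u : ℕ => (u + (q - K₀ % q)) % q)),
        c < e ∧ ∀ q ∈ e.primeFactors, (K₀ + c) % q ∈ Kcl q := by
      intro c hc
      rw [Finset.mem_filter, Finset.mem_range] at hc
      refine ⟨hc.1, fun q hq => ?_⟩
      have hqq := Nat.prime_of_mem_primeFactors hq
      exact (mod_mem_shift_iff hqq.pos K₀ c (hKlt q hqq)).1 (hc.2 q hq)
    refine sum_adm_le_sum_divisors (K₀ := K₀) he0 _ ?_ _ F hF0 ?_
    · intro c₁ hc₁ c₂ hc₂ hgcd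
      obtain ⟨h1, h1'⟩ := hadm c₁ hc₁
      obtain ⟨h2, h2'⟩ := hadm c₂ hc₂
      exact adm_class_unique hsq Kcl t (fun q hq => hK01 q (Nat.prime_of_mem_primeFactors hq))
        h1 h2 h1' h2' hgcd
    · intro c hc
      obtain ⟨hce, -⟩ := hadm c hc
      obtain ⟨hu, hcop, hle⟩ := classSum_le he0' hce hK
      refine hle.trans ?_
      exact add_le_add (hMxle _ _ _ hu hcop) (hMxle _ _ _ hu hcop)
  -- step 2: pairs
  have step2 := sum_divisors_pairs_le (primesProdBelow w) L F hF0
  -- step 3: Bombieri–Vinogradov at `X_g`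
  have step3 : ∀ g ∈ Finset.Icc 1 Lf, ∑ e' ∈ Finset.Icc 1 (Lf / g), F g e' ≤
      2 * (Cb * ((2 * (x : ℝ) + 2) / ((d : ℝ) * g)) / ℓ ^ 3) := by
    intro g hg
    obtain ⟨hX₀, hQ, hlog⟩ := hlev g hg
    have hg1 : 1 ≤ g := (Finset.mem_Icc.1 hg).1
    have hg' : (0 : ℝ) < g := by exact_mod_cast hg1
    set Xg : ℝ := (2 * (x : ℝ) + 2) / ((d : ℝ) * g) with hXg
    have hXg0 : 0 < Xg := by positivity
    have hlog0 : 0 < Real.log Xg := hℓ.trans_le hlog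
    have hh : ∀ K : ℕ, (K : ℝ) ≤ (2 * (x : ℝ) + 2) / d → ((K / g : ℕ) : ℝ) ≤ Xg := by
      intro K hKle
      calc ((K / g : ℕ) : ℝ) ≤ (K : ℝ) / g := Nat.cast_div_le
        _ ≤ ((2 * (x : ℝ) + 2) / d) / g := div_le_div_of_nonneg_right hKle hg'.le
        _ = Xg := by rw [hXg, div_div]
    have hK₀' : (K₀ : ℝ) ≤ (2 * (x : ℝ) + 2) / d := le_trans (by exact_mod_cast hK) hK₁
    have hBVg := hBV Xg hX₀ (Lf / g) hQ
    have b1 := sum_maxClass_le (K₁ / g) (hh K₁ hK₁) hBVg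
    have b0 := sum_maxClass_le (K₀ / g) (hh K₀ hK₀') hBVg
    have hpow : Cb * Xg / Real.log Xg ^ (3 : ℝ) ≤ Cb * Xg / ℓ ^ 3 := by
      rw [show (3 : ℝ) = ((3 : ℕ) : ℝ) by norm_num, Real.rpow_natCast]
      exact div_le_div_of_nonneg_left (by positivity) (by positivity)
        (pow_le_pow_left₀ hℓ.le hlog 3)
    have hsum : ∑ e' ∈ Finset.Icc 1 (Lf / g), F g e' =
        ∑ e' ∈ Finset.Icc 1 (Lf / g), Mx (K₁ / g) e' + ∑ e' ∈ Finset.Icc 1 (Lf / g), Mx (K₀ / g) e' := by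
      rw [← Finset.sum_add_distrib]
    rw [hsum]
    have e1 : ∑ e' ∈ Finset.Icc 1 (Lf / g), Mx (K₁ / g) e' ≤ Cb * Xg / Real.log Xg ^ (3 : ℝ) := b1
    have e0 : ∑ e' ∈ Finset.Icc 1 (Lf / g), Mx (K₀ / g) e' ≤ Cb * Xg / Real.log Xg ^ (3 : ℝ) := b0
    linarith
  -- step 4: the harmonic sum
  have step4 : ∑ g ∈ Finset.Icc 1 Lf, 2 * (Cb * ((2 * (x : ℝ) + 2) / ((d : ℝ) * g)) / ℓ ^ 3) ≤
      2 * Cb * ((2 * (x : ℝ) + 2) / d) * (1 + Real.log L) / ℓ ^ 3 := by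
    have e : ∀ g ∈ Finset.Icc 1 Lf, 2 * (Cb * ((2 * (x : ℝ) + 2) / ((d : ℝ) * g)) / ℓ ^ 3) =
        (2 * Cb * ((2 * (x : ℝ) + 2) / d) / ℓ ^ 3) * ((1 : ℝ) / g) := by
      intro g hg
      have hg' : (0 : ℝ) < g := by exact_mod_cast (Finset.mem_Icc.1 hg).1
      field_simp
    rw [Finset.sum_congr rfl e, ← Finset.mul_sum]
    have hh := sum_Icc_inv_le_log hL1
    have h0 : 0 ≤ 2 * Cb * ((2 * (x : ℝ) + 2) / d) / ℓ ^ 3 := by positivity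
    calc 2 * Cb * ((2 * (x : ℝ) + 2) / d) / ℓ ^ 3 * ∑ g ∈ Finset.Icc 1 Lf, (1 : ℝ) / g
        ≤ 2 * Cb * ((2 * (x : ℝ) + 2) / d) / ℓ ^ 3 * (1 + Real.log L) :=
          mul_le_mul_of_nonneg_left hh h0
      _ = _ := by ring
  exact (Finset.sum_le_sum step1).trans (step2.trans ((Finset.sum_le_sum step3).trans step4))

end Summit.Parity.GeneralizedHardyLittlewood.Theorems.ParityLeakOneFifth
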